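import Mathlib.MeasureTheory.Integral.MeanInequalities
import Mathlib.MeasureTheory.Function.LpSeminorm.CompareExp
import Mathlib.MeasureTheory.Integral.Prod
import Mathlib.Topology.Algebra.InfiniteSum.ENNReal
import Literature.Analysis.FluidPDE.LocalTypeI
import HarnessLib

/-!
# Lower semicontinuity of the Albritton–Barker quantities `C` and `A` under strong `L³` limits

Trunk T-FLUID (`Literature/Analysis/FluidPDE`), family NS; proofs layer over
`Literature/Analysis/FluidPDE/LocalTypeI.lean` (Albritton–Barker 2019, Thm 1.1). No new
definitions.

In the proof of Thm 1.1 (A–B §3, reverse direction) the bound `𝐈(u) < ∞` for the limit `(u, p)`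
of the rescaled solutions "follows from (3.3)", the uniform bound `sup_k 𝐈(v^{(k)}, Q(2)) < ∞`,
i.e. from the lower semicontinuity of the four scaled quantities under the convergences of
Lemma 2.2 (`v^{(k)} → u` in `L³_loc`, `q^{(k)} ⇀ p` in `L^{3/2}_loc`). This file proves the two
velocity statements, for a parabolic ball `Q(z, r)` contained in the region `Q₀` of strong `L³`
convergence and a common bound `M` of the approximants:

* `cknC_le_of_tendsto_eLpNorm`: `C(Q(z,r); u) ≤ M` if `C(Q(z,r); v_k) ≤ M` for all `k`
  (Minkowski in `L³(Q(z,r))` and `‖v_k - u‖_{L³} → 0`);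
* `cknAEss_le_of_tendsto_eLpNorm`: `A(Q(z,r); u) ≤ M` if `A(Q(z,r); v_k) ≤ M` for all `k`:
  `L³` convergence on the ball gives `∫_{t} ∫_{B} |v_k - u|² → 0` (Tonelli), hence along a
  subsequence `∫_B |v_{k_j}(t) - u(t)|² → 0` for a.e. `t` (summable subsequence), and Minkowski
  in `L²(B)` at such `t` passes the a.e. bound `r⁻¹ ∫_B |v_k(t)|² ≤ M` to the limit.

## References

* D. Albritton, T. Barker, *On local Type I singularities of the Navier–Stokes equations and
  Liouville theorems*, J. Math. Fluid Mech. 21 (2019), arXiv:1811.00502, §3 (proof of Thm 1.1,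
  "(3.6) follows from (3.3)").
-/

noncomputable section

open MeasureTheory Set Function Filter Topology TopologicalSpace Metric
open scoped NNReal ENNReal InnerProductSpace RealInnerProductSpace

namespace Literature.Analysis.FluidPDE

/-! ### Tools -/

section Tools

/-- From a sequence tending to `0` in `ℝ≥0∞` one can extract a subsequence with summable (indeed
geometrically small) terms. [folklore] -/
theorem exists_strictMono_tsum_ne_top {d : ℕ → ℝ≥0∞} (hd : Tendsto d atTop (𝓝 0)) :
    ∃ φ : ℕ → ℕ, StrictMono φ ∧ ∑' j, d (φ j) ≠ ∞ := by
  have h : ∀ n : ℕ, ∀ᶠ k in atTop, d k ≤ (2⁻¹ : ℝ≥0∞) ^ n := fun n =>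
    ((tendsto_order.1 hd).2 _ (ENNReal.pow_pos (by norm_num) n)).mono fun k hk => hk.le
  obtain ⟨φ, hφ, hφd⟩ := extraction_forall_of_eventually h
  refine ⟨φ, hφ, ne_top_of_le_ne_top ?_ (ENNReal.tsum_le_tsum hφd)⟩
  rw [ENNReal.tsum_geometric, ENNReal.one_sub_inv_two, inv_inv]
  exact ENNReal.ofNat_ne_top

end Tools

/-! ### `C` is lower semicontinuous under strong `L³` convergence -/

section C

variable {Q₀ : Set (ℝ × EuclideanSpace ℝ (Fin 3))} {r : ℝ} {z : ℝ × EuclideanSpace ℝ (Fin 3)}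
  {v : ℕ → ℝ → EuclideanSpace ℝ (Fin 3) → EuclideanSpace ℝ (Fin 3)}
  {u : ℝ → EuclideanSpace ℝ (Fin 3) → EuclideanSpace ℝ (Fin 3)} {M : ℝ≥0∞}

/-- **`C(Q(z,r))` passes to strong `L³` limits.** If `v_k → u` in `L³(Q₀)`,
`Q(z, r) ⊆ Q₀`, `r > 0`, and `C(Q(z,r); v_k) = r⁻² ∫_{Q(z,r)} |v_k|³ ≤ M` for all `k`, then
`C(Q(z,r); u) ≤ M` (Minkowski: `‖u‖_{L³(Q(z,r))} ≤ ‖v_k‖_{L³} + ‖v_k - u‖_{L³}`; Albritton–Barker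
2019, §3, the step "(3.6) follows from (3.3)" for the quantity `C`). [cite: AlbrittonBarker2019, §3] -/
theorem cknC_le_of_tendsto_eLpNorm (hr : 0 < r) (hQ : FluidPDE.parabolicCylinder r z ⊆ Q₀)
    (hv : ∀ k, AEStronglyMeasurable (uncurry (v k)) (volume.restrict Q₀))
    (hu : AEStronglyMeasurable (uncurry u) (volume.restrict Q₀))
    (hconv : Tendsto (fun k => eLpNorm (uncurry (v k) - uncurry u) 3 (volume.restrict Q₀))
      atTop (𝓝 0))
    (hbound : ∀ k, FluidPDE.cknC r z (v k) ≤ M) : FluidPDE.cknC r z u ≤ M := by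
  set Q' := FluidPDE.parabolicCylinder r z with hQ'
  set μ' : Measure (ℝ × EuclideanSpace ℝ (Fin 3)) := volume.restrict Q' with hμ'
  have hμle : μ' ≤ volume.restrict Q₀ := Measure.restrict_mono hQ le_rfl
  have hr2 : (ENNReal.ofReal r ^ 2) ≠ 0 := pow_ne_zero _ ((ENNReal.ofReal_pos.2 hr).ne')
  have hr2' : (ENNReal.ofReal r ^ 2) ≠ ∞ := ENNReal.pow_ne_top ENNReal.ofReal_ne_top
  -- the cubes as real powers
  have hcube : ∀ f : ℝ → EuclideanSpace ℝ (Fin 3) → EuclideanSpace ℝ (Fin 3),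
      ∫⁻ q in Q', ‖f q.1 q.2‖ₑ ^ (3 : ℕ) = ∫⁻ q, ‖uncurry f q‖ₑ ^ (3 : ℝ) ∂μ' := by
    intro f
    refine lintegral_congr fun q => ?_
    show ‖uncurry f q‖ₑ ^ (3 : ℕ) = ‖uncurry f q‖ₑ ^ (3 : ℝ)
    rw [← ENNReal.rpow_natCast]
    norm_num
  -- bound on the approximants: `∫ |v_k|³ ≤ r² M`
  have hvk : ∀ k, (∫⁻ q, ‖uncurry (v k) q‖ₑ ^ (3 : ℝ) ∂μ') ^ (1 / (3 : ℝ)) ≤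
      (ENNReal.ofReal r ^ 2 * M) ^ (1 / (3 : ℝ)) := by
    intro k
    refine ENNReal.rpow_le_rpow ?_ (by norm_num)
    rw [← hcube]
    exact (ENNReal.inv_mul_le_iff hr2 hr2').1 (hbound k)
  -- the error terms `ε_k = ‖v_k - u‖_{L³(Q')} → 0`
  set ε : ℕ → ℝ≥0∞ := fun k => (∫⁻ q, ‖(uncurry (v k) - uncurry u) q‖ₑ ^ (3 : ℝ) ∂μ') ^
    (1 / (3 : ℝ)) with hε
  have hε' : ∀ k, ε k = eLpNorm (uncurry (v k) - uncurry u) 3 μ' := by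
    intro k
    rw [hε, eLpNorm_eq_lintegral_rpow_enorm_toReal (by norm_num) (by norm_num)]
    norm_num
  have hεlim : Tendsto ε atTop (𝓝 0) := by
    refine tendsto_of_tendsto_of_tendsto_of_le_of_le tendsto_const_nhds hconv
      (fun k => bot_le) fun k => ?_
    rw [hε']
    exact eLpNorm_mono_measure _ hμle
  -- Minkowski: `‖u‖₃ ≤ ‖v_k‖₃ + ε_k ≤ (r² M)^{1/3} + ε_k`
  set X := (∫⁻ q, ‖uncurry u q‖ₑ ^ (3 : ℝ) ∂μ') ^ (1 / (3 : ℝ)) with hX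
  have hXle : ∀ k, X ≤ (ENNReal.ofReal r ^ 2 * M) ^ (1 / (3 : ℝ)) + ε k := by
    intro k
    have hfm : AEMeasurable (fun q => ‖uncurry (v k) q‖ₑ) μ' :=
      ((hv k).mono_measure hμle).enorm
    have hgm : AEMeasurable (fun q => ‖(uncurry (v k) - uncurry u) q‖ₑ) μ' :=
      (((hv k).sub hu).mono_measure hμle).enorm
    have h1 : X ≤ (∫⁻ q, ((fun q => ‖uncurry (v k) q‖ₑ) + fun q => ‖(uncurry (v k) - uncurry u) q‖ₑ)
        q ^ (3 : ℝ) ∂μ') ^ (1 / (3 : ℝ)) := by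
      refine ENNReal.rpow_le_rpow (lintegral_mono fun q => ?_) (by norm_num)
      refine ENNReal.rpow_le_rpow ?_ (by norm_num)
      simp only [Pi.add_apply, Pi.sub_apply]
      calc ‖uncurry u q‖ₑ = ‖uncurry (v k) q - (uncurry (v k) q - uncurry u q)‖ₑ := by
            rw [sub_sub_cancel]
        _ ≤ ‖uncurry (v k) q‖ₑ + ‖uncurry (v k) q - uncurry u q‖ₑ := enorm_sub_le
    refine h1.trans ((ENNReal.lintegral_Lp_add_le hfm hgm (by norm_num)).trans ?_)
    exact add_le_add (hvk k) le_rfl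
  have hXle' : X ≤ (ENNReal.ofReal r ^ 2 * M) ^ (1 / (3 : ℝ)) := by
    have ht : Tendsto (fun k => (ENNReal.ofReal r ^ 2 * M) ^ (1 / (3 : ℝ)) + ε k) atTop
        (𝓝 ((ENNReal.ofReal r ^ 2 * M) ^ (1 / (3 : ℝ)))) := by
      have := (tendsto_const_nhds (x := (ENNReal.ofReal r ^ 2 * M) ^ (1 / (3 : ℝ)))
        (f := (atTop : Filter ℕ))).add hεlim
      rwa [add_zero] at this
    exact ge_of_tendsto' ht hXle
  -- cube and divide by `r²`
  have hX3 : ∫⁻ q, ‖uncurry u q‖ₑ ^ (3 : ℝ) ∂μ' ≤ ENNReal.ofReal r ^ 2 * M := by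
    have := ENNReal.rpow_le_rpow hXle' (by norm_num : (0 : ℝ) ≤ 3)
    rwa [hX, ← ENNReal.rpow_mul, ← ENNReal.rpow_mul, show (1 / (3 : ℝ)) * 3 = 1 by norm_num,
      ENNReal.rpow_one, ENNReal.rpow_one] at this
  rw [FluidPDE.cknC, hcube]
  exact (ENNReal.inv_mul_le_iff hr2 hr2').2 hX3

end C

/-! ### `A` is lower semicontinuous under strong `L³` convergence -/

section A

variable {Q₀ : Set (ℝ × EuclideanSpace ℝ (Fin 3))} {r : ℝ} {z : ℝ × EuclideanSpace ℝ (Fin 3)}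
  {v : ℕ → ℝ → EuclideanSpace ℝ (Fin 3) → EuclideanSpace ℝ (Fin 3)}
  {u : ℝ → EuclideanSpace ℝ (Fin 3) → EuclideanSpace ℝ (Fin 3)} {M : ℝ≥0∞}

/-- **`A(Q(z,r))` passes to strong `L³` limits.** If `v_k → u` in `L³(Q₀)`, `Q(z, r) ⊆ Q₀`,
`r > 0`, and `A(Q(z,r); v_k) = esssup_{t} r⁻¹ ∫_{B(x,r)} |v_k(t)|² ≤ M` for all `k`, then
`A(Q(z,r); u) ≤ M`: by Tonelli `∫_t ∫_B |v_k - u|² → 0`, so along a summable subsequence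
`∫_B |v_{k_j}(t) - u(t)|² → 0` for a.e. `t`, and at every such `t` at which all the a.e. bounds
`r⁻¹ ∫_B |v_k(t)|² ≤ M` hold, Minkowski in `L²(B)` gives `r⁻¹ ∫_B |u(t)|² ≤ M`
(Albritton–Barker 2019, §3, the step "(3.6) follows from (3.3)" for the quantity `A`).
[cite: AlbrittonBarker2019, §3] -/
theorem cknAEss_le_of_tendsto_eLpNorm (hr : 0 < r) (hQ : FluidPDE.parabolicCylinder r z ⊆ Q₀)
    (hv : ∀ k, AEStronglyMeasurable (uncurry (v k)) (volume.restrict Q₀))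
    (hu : AEStronglyMeasurable (uncurry u) (volume.restrict Q₀))
    (hconv : Tendsto (fun k => eLpNorm (uncurry (v k) - uncurry u) 3 (volume.restrict Q₀))
      atTop (𝓝 0))
    (hbound : ∀ k, cknAEss r z (v k) ≤ M) : cknAEss r z u ≤ M := by
  set I := Ioo (z.1 - r ^ 2) z.1 with hI
  set B := ball z.2 r with hB
  set Q' := FluidPDE.parabolicCylinder r z with hQ'
  have hQ'eq : Q' = I ×ˢ B := rfl
  set μ' : Measure (ℝ × EuclideanSpace ℝ (Fin 3)) := volume.restrict Q' with hμ'
  have hμle : μ' ≤ volume.restrict Q₀ := Measure.restrict_mono hQ le_rfl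
  have hμ'prod : μ' = (volume.restrict I).prod (volume.restrict B) := by
    rw [hμ', hQ'eq, Measure.prod_restrict, ← Measure.volume_eq_prod]
  have hr0 : ENNReal.ofReal r ≠ 0 := (ENNReal.ofReal_pos.2 hr).ne'
  have hr0' : ENNReal.ofReal r ≠ ∞ := ENNReal.ofReal_ne_top
  -- (1) the a.e. bounds on the approximants
  have hae_bound : ∀ᵐ t ∂(volume.restrict I), ∀ k,
      ∫⁻ x in B, ‖v k t x‖ₑ ^ (2 : ℝ) ≤ ENNReal.ofReal r * M := by
    rw [ae_all_iff]
    intro k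
    filter_upwards [ENNReal.ae_le_essSup fun t : ℝ => (ENNReal.ofReal r)⁻¹ *
      ∫⁻ x in ball z.2 r, ‖v k t x‖ₑ ^ 2] with t ht
    have h2 : (ENNReal.ofReal r)⁻¹ * ∫⁻ x in B, ‖v k t x‖ₑ ^ 2 ≤ M := ht.trans (hbound k)
    have e : ∫⁻ x in B, ‖v k t x‖ₑ ^ (2 : ℝ) = ∫⁻ x in B, ‖v k t x‖ₑ ^ 2 :=
      lintegral_congr fun x => by rw [← ENNReal.rpow_natCast]; norm_num
    rw [e]
    exact (ENNReal.inv_mul_le_iff hr0 hr0').1 h2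
  -- (2) `d_k = ∫_{Q'} |v_k - u|² → 0`
  set w : ℕ → ℝ × EuclideanSpace ℝ (Fin 3) → ℝ≥0∞ :=
    fun k q => ‖(uncurry (v k) - uncurry u) q‖ₑ ^ (2 : ℝ) with hw
  have hwm : ∀ k, AEMeasurable (w k) μ' := fun k =>
    ((((hv k).sub hu).mono_measure hμle).enorm.pow_const _)
  have hd : Tendsto (fun k => ∫⁻ q, w k q ∂μ') atTop (𝓝 0) := by
    -- `(∫ |v_k - u|²)^{1/2} = ‖v_k - u‖_{L²(Q')} ≤ ‖v_k - u‖_{L³(Q')} vol(Q')^{1/6} → 0`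
    have hfin : μ' univ < ∞ := by
      rw [hμ', Measure.restrict_apply_univ, hQ'eq]
      refine (measure_mono (Set.prod_mono Ioo_subset_Icc_self
        (ball_subset_closedBall : B ⊆ closedBall z.2 r))).trans_lt ?_
      exact (isCompact_Icc.prod (isCompact_closedBall z.2 r)).measure_lt_top
    have h2 : ∀ k, eLpNorm (uncurry (v k) - uncurry u) 2 μ' ≤
        eLpNorm (uncurry (v k) - uncurry u) 3 (volume.restrict Q₀) *
          μ' univ ^ (1 / (2 : ℝ≥0∞).toReal - 1 / (3 : ℝ≥0∞).toReal) := by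
      intro k
      refine (eLpNorm_le_eLpNorm_mul_rpow_measure_univ (p := 2) (q := 3) (by norm_num)
        (((hv k).sub hu).mono_measure hμle)).trans ?_
      exact mul_le_mul' (eLpNorm_mono_measure _ hμle) le_rfl
    have h3 : Tendsto (fun k => eLpNorm (uncurry (v k) - uncurry u) 2 μ') atTop (𝓝 0) := by
      refine tendsto_of_tendsto_of_tendsto_of_le_of_le tendsto_const_nhds ?_ (fun k => bot_le) h2
      have := ENNReal.Tendsto.mul_const hconv (Or.inr (ENNReal.rpow_ne_top_of_nonneg
        (y := 1 / (2 : ℝ≥0∞).toReal - 1 / (3 : ℝ≥0∞).toReal) (by norm_num) hfin.ne))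
      rwa [zero_mul] at this
    have h4 : ∀ k, ∫⁻ q, w k q ∂μ' = eLpNorm (uncurry (v k) - uncurry u) 2 μ' ^ (2 : ℝ) := by
      intro k
      show ∫⁻ q, ‖(uncurry (v k) - uncurry u) q‖ₑ ^ (2 : ℝ) ∂μ' = _
      rw [eLpNorm_eq_lintegral_rpow_enorm_toReal two_ne_zero ENNReal.ofNat_ne_top,
        ENNReal.toReal_ofNat, one_div, ENNReal.rpow_inv_rpow two_ne_zero]
    simp_rw [h4]
    have := ((ENNReal.continuous_rpow_const (y := (2 : ℝ))).tendsto 0).comp h3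
    rw [ENNReal.zero_rpow_of_pos two_pos] at this
    exact this
  -- (3) Tonelli and a summable subsequence: `e_{k_j}(t) → 0` for a.e. `t`
  set e : ℕ → ℝ → ℝ≥0∞ := fun k t => ∫⁻ x in B, w k (t, x) with he
  have hem : ∀ k, AEMeasurable (e k) (volume.restrict I) := by
    intro k
    have := (hwm k)
    rw [hμ'prod] at this
    exact this.lintegral_prod_right'
  have hde : ∀ k, ∫⁻ q, w k q ∂μ' = ∫⁻ t in I, e k t := by
    intro k
    have := (hwm k)
    rw [hμ'prod] at this ⊢
    exact lintegral_prod _ this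
  obtain ⟨φ, hφ, hsum⟩ := exists_strictMono_tsum_ne_top hd
  have hae_lim : ∀ᵐ t ∂(volume.restrict I), Tendsto (fun j => e (φ j) t) atTop (𝓝 0) := by
    have h1 : ∫⁻ t in I, ∑' j, e (φ j) t ≠ ∞ := by
      rw [lintegral_tsum fun j => hem (φ j)]
      simp_rw [← hde]
      exact hsum
    filter_upwards [ae_lt_top' (AEMeasurable.tsum fun j => hem (φ j)) h1] with t ht
    exact ENNReal.tendsto_atTop_zero_of_tsum_ne_top ht.ne
  -- (4) measurability of the slices
  have hae_meas : ∀ᵐ t ∂(volume.restrict I), ∀ k,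
      AEStronglyMeasurable (fun x => v k t x) (volume.restrict B) ∧
        AEStronglyMeasurable (fun x => v k t x - u t x) (volume.restrict B) := by
    rw [ae_all_iff]
    intro k
    have h1 := (hv k).mono_measure hμle
    have h2 := ((hv k).sub hu).mono_measure hμle
    rw [hμ'prod] at h1 h2
    filter_upwards [h1.prodMk_left, h2.prodMk_left] with t ht1 ht2
    exact ⟨ht1, ht2⟩
  -- (5) the pointwise argument at good times
  have key : ∀ᵐ t ∂(volume.restrict I),
      (ENNReal.ofReal r)⁻¹ * ∫⁻ x in B, ‖u t x‖ₑ ^ 2 ≤ M := by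
    filter_upwards [hae_bound, hae_lim, hae_meas] with t hbt hlt hmt
    -- `a = ∫_B |u(t)|²` as a real power
    have e2 : ∫⁻ x in B, ‖u t x‖ₑ ^ 2 = ∫⁻ x in B, ‖u t x‖ₑ ^ (2 : ℝ) :=
      lintegral_congr fun x => by rw [← ENNReal.rpow_natCast]; norm_num
    rw [e2]
    refine (ENNReal.inv_mul_le_iff hr0 hr0').2 ?_
    set a := (∫⁻ x in B, ‖u t x‖ₑ ^ (2 : ℝ)) ^ (1 / (2 : ℝ)) with ha
    -- Minkowski at each `j`
    have hale : ∀ j, a ≤ (ENNReal.ofReal r * M) ^ (1 / (2 : ℝ)) + (e (φ j) t) ^ (1 / (2 : ℝ)) := by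
      intro j
      set k := φ j with hk
      have hfm : AEMeasurable (fun x => ‖v k t x‖ₑ) (volume.restrict B) := (hmt k).1.enorm
      have hgm : AEMeasurable (fun x => ‖v k t x - u t x‖ₑ) (volume.restrict B) := (hmt k).2.enorm
      have h1 : a ≤ (∫⁻ x in B, ((fun x => ‖v k t x‖ₑ) + fun x => ‖v k t x - u t x‖ₑ) x ^ (2 : ℝ)) ^
          (1 / (2 : ℝ)) := by
        refine ENNReal.rpow_le_rpow (lintegral_mono fun x => ?_) (by norm_num)
        refine ENNReal.rpow_le_rpow ?_ (by norm_num)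
        simp only [Pi.add_apply]
        calc ‖u t x‖ₑ = ‖v k t x - (v k t x - u t x)‖ₑ := by rw [sub_sub_cancel]
          _ ≤ ‖v k t x‖ₑ + ‖v k t x - u t x‖ₑ := enorm_sub_le
      refine h1.trans ((ENNReal.lintegral_Lp_add_le hfm hgm (by norm_num)).trans ?_)
      refine add_le_add (ENNReal.rpow_le_rpow (hbt k) (by norm_num)) (le_of_eq ?_)
      rfl
    have hale' : a ≤ (ENNReal.ofReal r * M) ^ (1 / (2 : ℝ)) := by
      have ht2 : Tendsto (fun j => (e (φ j) t) ^ (1 / (2 : ℝ))) atTop (𝓝 0) := by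
        have := ((ENNReal.continuous_rpow_const (y := 1 / (2 : ℝ))).tendsto 0).comp hlt
        rw [ENNReal.zero_rpow_of_pos (by norm_num)] at this
        exact this
      have ht3 : Tendsto (fun j => (ENNReal.ofReal r * M) ^ (1 / (2 : ℝ)) +
          (e (φ j) t) ^ (1 / (2 : ℝ))) atTop (𝓝 ((ENNReal.ofReal r * M) ^ (1 / (2 : ℝ)))) := by
        have := (tendsto_const_nhds (x := (ENNReal.ofReal r * M) ^ (1 / (2 : ℝ)))
          (f := (atTop : Filter ℕ))).add ht2
        rwa [add_zero] at this
      exact ge_of_tendsto' ht3 hale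
    have := ENNReal.rpow_le_rpow hale' (by norm_num : (0 : ℝ) ≤ 2)
    rwa [ha, ← ENNReal.rpow_mul, ← ENNReal.rpow_mul, show (1 / (2 : ℝ)) * 2 = 1 by norm_num,
      ENNReal.rpow_one, ENNReal.rpow_one] at this
  exact essSup_le_of_ae_le M key

end A

end Literature.Analysis.FluidPDE
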